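import Literature.AlgebraicGeometry.KawanoueMatsuki2010.InvariantsAtClosedPoint
import Literature.AlgebraicGeometry.Kawanoue2007.LeadingGeneratorSystemExists
import HarnessLib

/-!
# Kawanoue–Matsuki 2010 (IFP Part II), §3.1.1 and Rem. 1.1.1.2 (2) at a closed point: an LGS of `𝕀_P` EXISTS; `0 ≤ σ(P)`, `σ(P)` non-increasing — PROVED

H. Kawanoue, K. Matsuki, *Toward resolution of singularities over a field of positive characteristic (the
Idealistic Filtration Program). Part II*, Publ. RIMS **46** (2010) 359–422 (= arXiv:math/0612008)
[KawanoueMatsuki2010], read on the held arXiv text (`lit read paper:arxiv-math-0612008`): setting chunk p0004 L7 /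
p0012 L13–L15 / p0041 L19–L25, §3.1.1 «Take a leading generator system `ℍ` … for the 𝔇-saturated idealistic
filtration `𝕀_P`» chunk p0041 L25, Def. 1.1.1.1 (`σ(P)`) chunk p0013 L3–L9 and **Rem. 1.1.1.2 (2)** chunk p0013
L24–L28: «The dimension of the pure part is non-decreasing as a function of `e ∈ ℤ_{≥0}`, and is uniformly bounded
from above by `d = dim W`, i.e., `0 ≤ l^{pure}_{p^0}(P) ≤ l^{pure}_{p^1}(P) ≤ ⋯ ≤ d = dim W` and hence
stabilizes after some point». PROOF file (theorems only, no named facts): the statements are the pointwise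
(`sigmaAt`, `𝕀.atPrime 𝔫`) readings of the general theorems of
`Kawanoue2007/LeadingGeneratorSystemExists.lean` (`exists_isLGS_of_smooth`, `lPure_le_of_smooth`,
`monotone_lPure_of_smooth`, `antitone_sigma_of_smooth`, `exists_forall_lPure_eq_of_smooth` — Kawanoue 2007
Lemma 3.1.2.1 «Moreover» part / Prop. 3.1.3.2, proved there). In particular the SECTION of leading generator
systems over the closed points on which `KawanoueMatsuki2010_prop_3_3_1_1` (upper semicontinuity of `(σ, μ̃)`)
is quantified EXISTS unconditionally (`exists_lgs_section`), for every idealistic filtration over the coordinate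
ring — so that named fact is not vacuous. Campaign `res-hironaka` (D-0089), rung LIT-6. Nothing of Hironaka's
2017 manuscript is referred to or asserted.

## References

* H. Kawanoue, K. Matsuki, Publ. RIMS 46 (2010) 359–422 = arXiv:math/0612008: §3.1.1, Def. 1.1.1.1, Rem. 1.1.1.2
  (2), Prop. 3.3.1.1 (hypothesis shape). [KawanoueMatsuki2010]
* H. Kawanoue, Publ. RIMS 43 (2007) 819–909 = arXiv:math/0607009: Prop. 3.1.3.2, Lemma 3.1.2.1, Def. 3.2.1.1.
  [Kawanoue2007]
-/

noncomputable section

namespace Literature.AlgebraicGeometry.KawanoueMatsuki2010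

open Literature.AlgebraicGeometry.Kawanoue2007
open IsLocalRing

universe u

/-- **§3.1.1 «Take a leading generator system `ℍ = {(h_l, p^{e_l})}` … for `𝕀_P`»** — one EXISTS, at every closed
point `𝔫` of `W = Spec A` (`A` smooth of finite type over `k` algebraically closed of exponential characteristic
`p`), for EVERY idealistic filtration `𝕀` over `A` (Part I Prop. 3.1.3.2, proved as
`Kawanoue2007.exists_isLGS_of_smooth`; no 𝔇-saturation is needed for existence).
[cite: KawanoueMatsuki2010, §3.1.1; Kawanoue2007, Prop. 3.1.3.2] -/
theorem exists_isLGS_atPrime (p : ℕ) (k : Type u) [Field k] [IsAlgClosed k] [ExpChar k p]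
    (A : Type u) [CommRing A] [Algebra k A] [Algebra.FiniteType k A] [Algebra.Smooth k A]
    (𝕀 : IdealisticFiltration A) (𝔫 : Ideal A) [𝔫.IsMaximal] :
    ∃ (N : ℕ) (h : Fin N → Localization.AtPrime 𝔫) (e : Fin N → ℕ), Monotone e ∧ IsLGS p (𝕀.atPrime 𝔫) h e :=
  exists_isLGS_of_smooth p k A 𝔫 (𝕀.atPrime 𝔫)

/-- **A SECTION of leading generator systems over the closed points exists** (one finite LGS of `𝕀_𝔫`, with
monotone exponents, for every `𝔫 ∈ MaximalSpectrum A`) — exactly the datum over which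
`KawanoueMatsuki2010_prop_3_3_1_1` is quantified, now for every idealistic filtration over the coordinate ring and
without any hypothesis. [cite: KawanoueMatsuki2010, §3.1.1, Prop. 3.3.1.1; Kawanoue2007, Prop. 3.1.3.2] -/
theorem exists_lgs_section (p : ℕ) (k : Type u) [Field k] [IsAlgClosed k] [ExpChar k p]
    (A : Type u) [CommRing A] [Algebra k A] [Algebra.FiniteType k A] [Algebra.Smooth k A]
    (𝕀 : IdealisticFiltration A) :
    ∃ (N : MaximalSpectrum A → ℕ)
      (h : ∀ 𝔫 : MaximalSpectrum A, Fin (N 𝔫) → Localization.AtPrime 𝔫.asIdeal)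
      (e : ∀ 𝔫 : MaximalSpectrum A, Fin (N 𝔫) → ℕ),
      ∀ 𝔫, Monotone (e 𝔫) ∧ IsLGS p (𝕀.atPrime 𝔫.asIdeal) (h 𝔫) (e 𝔫) := by
  choose N h e hmono hLGS using fun 𝔫 : MaximalSpectrum A => exists_isLGS_atPrime p k A 𝕀 𝔫.asIdeal
  exact ⟨N, h, e, fun 𝔫 => ⟨hmono 𝔫, hLGS 𝔫⟩⟩

/-- **Rem. 1.1.1.2 (2): `0 ≤ l^{pure}_{p^e}(P) ≤ d = dim W`** — here `d = dim A` (`ringKrullDim A = d`).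
[cite: KawanoueMatsuki2010, Rem. 1.1.1.2 (2)] -/
theorem lPure_atPrime_le (p : ℕ) (k : Type u) [Field k] [IsAlgClosed k] [ExpChar k p]
    (A : Type u) [CommRing A] [Algebra k A] [Algebra.FiniteType k A] [Algebra.Smooth k A]
    {d : ℕ} (hd : ringKrullDim A = d) (𝕀 : IdealisticFiltration A) (𝔫 : Ideal A) [𝔫.IsMaximal] (e : ℕ) :
    lPure (𝕀.atPrime 𝔫) (p ^ e) ≤ d :=
  lPure_le_of_smooth p k A 𝔫 hd (𝕀.atPrime 𝔫) e

/-- **Rem. 1.1.1.2 (2): every component of `σ(P) = (d − l^{pure}_{p^e}(P))_e` is `≥ 0`** (`d = dim A`), i.e.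
`σ(P) ∈ ∏ ℤ_{≥0}` as printed in Def. 1.1.1.1 / Prop. 3.3.1.1. [cite: KawanoueMatsuki2010, Def. 1.1.1.1 with Rem. 1.1.1.2 (2)] -/
theorem sigmaAt_nonneg (p : ℕ) (k : Type u) [Field k] [IsAlgClosed k] [ExpChar k p]
    (A : Type u) [CommRing A] [Algebra k A] [Algebra.FiniteType k A] [Algebra.Smooth k A]
    {d : ℕ} (hd : ringKrullDim A = d) (𝕀 : IdealisticFiltration A) (𝔫 : Ideal A) [𝔫.IsMaximal] (e : ℕ) :
    0 ≤ sigmaAt p d 𝕀 𝔫 e :=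
  sigma_nonneg_of_smooth p k A 𝔫 hd (𝕀.atPrime 𝔫) e

/-- **Rem. 1.1.1.2 (2): `l^{pure}_{p^e}(P)` is non-decreasing in `e`.** [cite: KawanoueMatsuki2010, Rem. 1.1.1.2 (2)] -/
theorem monotone_lPure_atPrime (p : ℕ) (k : Type u) [Field k] [IsAlgClosed k] [ExpChar k p]
    (A : Type u) [CommRing A] [Algebra k A] [Algebra.FiniteType k A] [Algebra.Smooth k A]
    (𝕀 : IdealisticFiltration A) (𝔫 : Ideal A) [𝔫.IsMaximal] :
    Monotone fun e => lPure (𝕀.atPrime 𝔫) (p ^ e) :=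
  monotone_lPure_of_smooth p k A 𝔫 (𝕀.atPrime 𝔫)

/-- Hence **`σ(P)` is a non-increasing sequence.** [cite: KawanoueMatsuki2010, Rem. 1.1.1.2 (2)] -/
theorem antitone_sigmaAt (p : ℕ) (k : Type u) [Field k] [IsAlgClosed k] [ExpChar k p]
    (A : Type u) [CommRing A] [Algebra k A] [Algebra.FiniteType k A] [Algebra.Smooth k A]
    (d : ℕ) (𝕀 : IdealisticFiltration A) (𝔫 : Ideal A) [𝔫.IsMaximal] :
    Antitone (sigmaAt p d 𝕀 𝔫) :=
  antitone_sigma_of_smooth p k A 𝔫 d (𝕀.atPrime 𝔫)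

/-- **Rem. 1.1.1.2 (2): «… and hence stabilizes after some point, i.e., there exists `e_M` such that for
`e > e_M` the above inequalities become equalities».** [cite: KawanoueMatsuki2010, Rem. 1.1.1.2 (2)] -/
theorem exists_forall_lPure_atPrime_eq (p : ℕ) (k : Type u) [Field k] [IsAlgClosed k] [ExpChar k p]
    (A : Type u) [CommRing A] [Algebra k A] [Algebra.FiniteType k A] [Algebra.Smooth k A]
    (𝕀 : IdealisticFiltration A) (𝔫 : Ideal A) [𝔫.IsMaximal] :
    ∃ E : ℕ, ∀ e, E ≤ e → lPure (𝕀.atPrime 𝔫) (p ^ e) = lPure (𝕀.atPrime 𝔫) (p ^ E) :=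
  exists_forall_lPure_eq_of_smooth p k A 𝔫 (𝕀.atPrime 𝔫)

/-- «Therefore, although `σ(P)` is an infinite sequence by definition, essentially we are only looking at some
finite part of it»: `σ(P)` is eventually constant. [cite: KawanoueMatsuki2010, Rem. 1.1.1.2 (2)] -/
theorem exists_forall_sigmaAt_eq (p : ℕ) (k : Type u) [Field k] [IsAlgClosed k] [ExpChar k p]
    (A : Type u) [CommRing A] [Algebra k A] [Algebra.FiniteType k A] [Algebra.Smooth k A]
    (d : ℕ) (𝕀 : IdealisticFiltration A) (𝔫 : Ideal A) [𝔫.IsMaximal] :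
    ∃ E : ℕ, ∀ e, E ≤ e → sigmaAt p d 𝕀 𝔫 e = sigmaAt p d 𝕀 𝔫 E := by
  obtain ⟨E, hE⟩ := exists_forall_lPure_atPrime_eq p k A 𝕀 𝔫
  refine ⟨E, fun e he => ?_⟩
  rw [sigmaAt_eq, sigma_apply, sigma_apply, hE e he]

end Literature.AlgebraicGeometry.KawanoueMatsuki2010

end
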